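import Summits.QuantumFields.YangMills.Theorems.VirialFluxGapFixGenericPointwise
import Summits.QuantumFields.YangMills.Theorems.VirialFluxGapFixFrameCount
import HarnessLib

/-!
# Route `VirialFluxGap` (YangMills): the RESOLVENT EULER FIELD on `X_fix` — PARAMETER CHOICE for the generic region:
# `η = ε/3`, `λ⋆ = εκ/3`, deficit window `D ≤ ε³κ²/(10⁴(K+1)²#ι⁵)` give (E1) with factor `1 − ε` and (E2) with error `≤ 1/8`

Toward the deciding crux `VirialFluxGap.PeriodicSoftness` (item stmt-QuantumFields-24141), resolvent Euler field (memo
`fcl-p3-g40-RESOLVENT-EULER-FIELD-24141-v3.md` §2).  The pointwise package ✓`fix_generic_drive_lower` ∕ ✓`fix_generic_divergence_upper` carries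
free parameters `λ⋆, η` and `u`-free error terms in `D = 1032960L⁸F₀(P)/ρ²`, `c = #ι = 18L⁴+3`, `κ = ρ²/(1032960L⁸)`.  This file makes the
choice and does the real arithmetic once:

* §1 `param_budget`, `param_smallness` (the hypothesis `K√(cD)c ≤ λ⋆/2`), `param_drive_error` (`1 − ε ≤` the (E1) coefficient),
  `param_divergence_error` (the two small (E2) terms `≤ 1/8`) — pure real inequalities under `0 < ε ≤ 1`, `K ≥ 0`, `κ > 0`, `c ≥ 21`,
  `0 ≤ D ≤ ε³κ²/(10⁴(K+1)²c⁵)`;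
* `param_window`: the single threshold `F₀ ≤ t₀ = ρ²ε³κ²/(1032960·10⁴·L⁸(K+1)²c⁵)` implies both point hypotheses;
* §2 ★★★ `fix_generic_drive_lower_eps`: `(1 − ε)·F₀(P) ≤ ½gᵀ(H + (εκ/3)1)⁻¹g` and ★★★ `fix_generic_divergence_upper_eps`:
  `½tr(A⁻¹H) − ½Σ_i(A⁻¹B_iA⁻¹g)_i ≤ ½(#ι − 4) + 1/8 = 9L⁴ − 3/8` at every slice-0 comb-gauged `ρ`-regular point with
  `224L²√F₀(P) < ρ` and `1032960L⁸F₀(P)/ρ² ≤ ε³κ²/(10⁴(K+1)²#ι⁵)` — i.e. in the normalisation `X = 2X_g` of «EulerFieldFix»: drive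
  `≥ 2(1 − ε)F₀`, divergence `≤ 18L⁴ − 3/4` on the generic region (before cut-off/patching terms), a POLYNOMIAL deficit window;
* §3 ★★★ `fix_generic_drive_lower_window` ∕ `fix_generic_divergence_upper_window`: the same two conclusions from the ONE hypothesis `F₀(P) ≤ t₀`
  (`t₀⁻¹` polynomial in `L` for fixed `ρ`, `ε·L⁴`, `K/L⁴` — the `(K·L^q)⁻¹` window of «EulerFieldFix»).

HONEST LABEL: pointwise, generic region only; cut-offs, central charts (w3), patching and the «EulerFieldFix» record are NOT here; the Euler
field is NOT assembled; ⟨24141⟩, ⟨22884⟩ remain OPEN; the Yang–Mills mass gap is NOT proved; no summit is proved by a line.  THEOREMS ONLY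
(0 `def`, 0 `sorry`), standard axioms.  Explicit-unit seat `ym-line-fcl-p3` g40 (cell ym-idea-1, free hands), `--supports stmt-QuantumFields-24141`.
References: [cite: Luscher1983, §2]; [folklore].
-/

set_option autoImplicit false

noncomputable section

open scoped Matrix BigOperators ContDiff Topology Quaternion
open MeasureTheory Set Matrix
open Literature.MathematicalPhysics.QuantumFieldTheory hiding SU2
open Literature.MathematicalPhysics.QuantumLattice
open Literature.MathematicalPhysics.QuantumFieldTheory.SUNBakryEmery (expSU coe_expSU matTop)

namespace Summit.QuantumFields.YangMills.Theorems.VirialFluxGap.FrameHessian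

open Summit.QuantumFields.YangMills.Theorems.FemtoTransferGap
open Summit.QuantumFields.YangMills.Theorems.FemtoTransferGap.TT
open Summit.QuantumFields.YangMills.Theorems.FemtoTransferGap.TwoLattice
open Summit.QuantumFields.YangMills.Theorems.FemtoTransferGap.TwoLattice.Flat
open Summit.QuantumFields.YangMills.Theorems.VirialFluxGap.RingDeficit
open Summit.QuantumFields.YangMills.Theorems.VirialFluxGap.FrameDerivative
open Summit.QuantumFields.YangMills.Theorems.VirialFluxGap.ResolventField
open Summit.QuantumFields.YangMills.Theorems.VirialFluxGap.RegularValley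
open Summit.QuantumFields.YangMills.Theorems.VirialFluxGap.FixFrame

/-! ## §1 The real arithmetic of the parameter choice -/


/-- The budget: `K²c³D ≤ ε³κ²/(10⁴c²)` when `D ≤ ε³κ²/(10⁴(K+1)²c⁵)`. [folklore] -/
theorem param_budget {ε K κ c D : ℝ} (hε : 0 < ε) (hK : 0 ≤ K) (hκ : 0 < κ) (hc : 21 ≤ c)
    (hD : D ≤ ε ^ 3 * κ ^ 2 / (10000 * (K + 1) ^ 2 * c ^ 5)) :
    K ^ 2 * c ^ 3 * D ≤ ε ^ 3 * κ ^ 2 / (10000 * c ^ 2) := by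
  have hc0 : 0 < c := by linarith
  have hK1 : K ^ 2 ≤ (K + 1) ^ 2 := by nlinarith
  calc K ^ 2 * c ^ 3 * D ≤ K ^ 2 * c ^ 3 * (ε ^ 3 * κ ^ 2 / (10000 * (K + 1) ^ 2 * c ^ 5)) :=
        mul_le_mul_of_nonneg_left hD (by positivity)
    _ = (K ^ 2 / (K + 1) ^ 2) * (ε ^ 3 * κ ^ 2 / (10000 * c ^ 2)) := by field_simp
    _ ≤ 1 * (ε ^ 3 * κ ^ 2 / (10000 * c ^ 2)) := by
        apply mul_le_mul_of_nonneg_right _ (by positivity)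
        rw [div_le_one (by positivity)]; exact hK1
    _ = ε ^ 3 * κ ^ 2 / (10000 * c ^ 2) := one_mul _

/-- The smallness hypothesis of the pointwise package: `K·√(cD)·c ≤ λ⋆/2` for `λ⋆ = εκ/3`. [folklore] -/
theorem param_smallness {ε K κ c D : ℝ} (hε : 0 < ε) (hε1 : ε ≤ 1) (hK : 0 ≤ K) (hκ : 0 < κ) (hc : 21 ≤ c) (hD0 : 0 ≤ D)
    (hD : D ≤ ε ^ 3 * κ ^ 2 / (10000 * (K + 1) ^ 2 * c ^ 5)) :
    K * Real.sqrt (c * D) * c ≤ (ε * κ / 3) / 2 := by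
  have hc0 : 0 < c := by linarith
  have hb := param_budget hε hK hκ hc hD
  have ha0 : 0 ≤ K * Real.sqrt (c * D) * c := by positivity
  rw [← pow_le_pow_iff_left₀ ha0 (by positivity) two_ne_zero]
  have e : (K * Real.sqrt (c * D) * c) ^ 2 = K ^ 2 * c ^ 3 * D := by
    rw [mul_pow, mul_pow, Real.sq_sqrt (by positivity)]; ring
  rw [e]
  calc K ^ 2 * c ^ 3 * D ≤ ε ^ 3 * κ ^ 2 / (10000 * c ^ 2) := hb
    _ ≤ ε ^ 2 * κ ^ 2 / 36 := by
        rw [div_le_div_iff₀ (by positivity) (by norm_num)]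
        have h1 : ε ^ 3 ≤ ε ^ 2 := by nlinarith
        have h2 : (36 : ℝ) ≤ 10000 * c ^ 2 := by nlinarith
        have h3 : 0 ≤ ε ^ 2 * κ ^ 2 := by positivity
        nlinarith [mul_le_mul_of_nonneg_right h1 (by positivity : 0 ≤ κ ^ 2 * 36), mul_le_mul_of_nonneg_left h2 h3]
    _ = (ε * κ / 3 / 2) ^ 2 := by ring

/-- The driving error: with `η = ε/3`, `λ⋆ = εκ/3` the (E1) coefficient is at least `1 − ε`. [folklore] -/
theorem param_drive_error {ε K κ c D : ℝ} (hε : 0 < ε) (hε1 : ε ≤ 1) (hK : 0 ≤ K) (hκ : 0 < κ) (hc : 21 ≤ c) (hD0 : 0 ≤ D)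
    (hD : D ≤ ε ^ 3 * κ ^ 2 / (10000 * (K + 1) ^ 2 * c ^ 5)) :
    1 - ε ≤ 1 - ε / 3 - (3 * K * (c * Real.sqrt c) * Real.sqrt D + (ε * κ / 3) / 2 +
        4 * K ^ 2 * c ^ 3 * D / ((ε / 3) * (ε * κ / 3))) / κ := by
  have hc0 : 0 < c := by linarith
  have hb := param_budget hε hK hκ hc hD
  -- T1 = 3K c√c √D / κ ≤ ε/10
  have hT1 : 3 * K * (c * Real.sqrt c) * Real.sqrt D ≤ ε / 10 * κ := by
    have ha0 : 0 ≤ 3 * K * (c * Real.sqrt c) * Real.sqrt D := by positivity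
    rw [← pow_le_pow_iff_left₀ ha0 (by positivity) two_ne_zero]
    have e : (3 * K * (c * Real.sqrt c) * Real.sqrt D) ^ 2 = 9 * (K ^ 2 * c ^ 3 * D) := by
      rw [mul_pow, mul_pow, mul_pow, mul_pow, Real.sq_sqrt hc0.le, Real.sq_sqrt hD0]; ring
    rw [e]
    calc 9 * (K ^ 2 * c ^ 3 * D) ≤ 9 * (ε ^ 3 * κ ^ 2 / (10000 * c ^ 2)) := by linarith
      _ ≤ (ε / 10 * κ) ^ 2 := by
          rw [show (ε / 10 * κ) ^ 2 = ε ^ 2 * κ ^ 2 / 100 by ring, mul_div_assoc', div_le_div_iff₀ (by positivity) (by norm_num)]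
          have h1 : ε ^ 3 ≤ ε ^ 2 := by nlinarith
          have h3 : 0 ≤ ε ^ 2 * κ ^ 2 := by positivity
          nlinarith [mul_le_mul_of_nonneg_right h1 (by positivity : 0 ≤ κ ^ 2 * 900), mul_le_mul_of_nonneg_left (show (900:ℝ) ≤ 10000 * c ^ 2 by nlinarith) h3]
  -- T3 = 36 K² c³ D/(ε² κ²) ≤ ε/100
  have hT3 : 4 * K ^ 2 * c ^ 3 * D / ((ε / 3) * (ε * κ / 3)) ≤ ε / 100 * κ := by
    rw [div_le_iff₀ (by positivity)]
    calc 4 * K ^ 2 * c ^ 3 * D = 4 * (K ^ 2 * c ^ 3 * D) := by ring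
      _ ≤ 4 * (ε ^ 3 * κ ^ 2 / (10000 * c ^ 2)) := by linarith
      _ ≤ ε / 100 * κ * (ε / 3 * (ε * κ / 3)) := by
          rw [show ε / 100 * κ * (ε / 3 * (ε * κ / 3)) = ε ^ 3 * κ ^ 2 / 900 by ring, mul_div_assoc', div_le_div_iff₀ (by positivity) (by norm_num)]
          have h3 : 0 ≤ ε ^ 3 * κ ^ 2 := by positivity
          nlinarith [mul_le_mul_of_nonneg_left (show (4 * 900 : ℝ) ≤ 10000 * c ^ 2 by nlinarith) h3]
  have hsum : (3 * K * (c * Real.sqrt c) * Real.sqrt D + (ε * κ / 3) / 2 + 4 * K ^ 2 * c ^ 3 * D / ((ε / 3) * (ε * κ / 3))) / κ ≤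
      ε / 10 + ε / 6 + ε / 100 := by
    rw [div_le_iff₀ hκ]
    nlinarith
  nlinarith



/-- The divergence error: with `λ⋆ = εκ/3` the two small terms of (E2) sum to at most `1/8`. [folklore] -/
theorem param_divergence_error {ε K κ c D : ℝ} (hε : 0 < ε) (hε1 : ε ≤ 1) (hK : 0 ≤ K) (hκ : 0 < κ) (hc : 21 ≤ c) (hD0 : 0 ≤ D)
    (hD : D ≤ ε ^ 3 * κ ^ 2 / (10000 * (K + 1) ^ 2 * c ^ 5)) :
    (1 / 2) * (4 * ((K * Real.sqrt (c * D) * c) / (K * Real.sqrt (c * D) * c + ε * κ / 3))) +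
      (1 / 2) * (c * ((c * K) / ((ε * κ / 3) / 2)) *
        Real.sqrt (3 * ((1 + (ε * κ / 3) ^ 2 / ((ε * κ / 3) / 2) ^ 2) * D + (2 * K * c * Real.sqrt c) ^ 2 * D ^ 2 / ((ε * κ / 3) / 2) ^ 2))) ≤
      1 / 8 := by
  have hc0 : 0 < c := by linarith
  have hb := param_budget hε hK hκ hc hD
  have hB0 : 0 ≤ K ^ 2 * c ^ 3 * D := by positivity
  have hlam0 : 0 < ε * κ / 3 := by positivity
  have hεκ : 0 < ε ^ 2 * κ ^ 2 := by positivity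
  have hε32 : ε ^ 3 * κ ^ 2 ≤ ε ^ 2 * κ ^ 2 := by
    have h1 : ε ^ 3 ≤ ε ^ 2 := by nlinarith
    exact mul_le_mul_of_nonneg_right h1 (by positivity)
  -- U1 ≤ 1/50
  have hsb0 : 0 ≤ K * Real.sqrt (c * D) * c := by positivity
  have hsb2 : (K * Real.sqrt (c * D) * c) ^ 2 = K ^ 2 * c ^ 3 * D := by
    rw [mul_pow, mul_pow, Real.sq_sqrt (by positivity)]; ring
  have hsb_le : K * Real.sqrt (c * D) * c ≤ ε * κ / 3 / 100 := by
    rw [← pow_le_pow_iff_left₀ hsb0 (by positivity) two_ne_zero, hsb2]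
    calc K ^ 2 * c ^ 3 * D ≤ ε ^ 3 * κ ^ 2 / (10000 * c ^ 2) := hb
      _ ≤ ε ^ 2 * κ ^ 2 / (10000 * c ^ 2) := div_le_div_of_nonneg_right hε32 (by positivity)
      _ ≤ ε ^ 2 * κ ^ 2 / 90000 := by
          apply div_le_div_of_nonneg_left hεκ.le (by norm_num)
          nlinarith
      _ = (ε * κ / 3 / 100) ^ 2 := by ring
  have hU1 : (K * Real.sqrt (c * D) * c) / (K * Real.sqrt (c * D) * c + ε * κ / 3) ≤ 1 / 100 := by
    rw [div_le_div_iff₀ (by positivity) (by norm_num)]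
    linarith
  -- U2 ≤ 1/15
  have h5 : (1 + (ε * κ / 3) ^ 2 / ((ε * κ / 3) / 2) ^ 2) = 5 := by field_simp; ring
  have hWeq : 3 * ((1 + (ε * κ / 3) ^ 2 / ((ε * κ / 3) / 2) ^ 2) * D + (2 * K * c * Real.sqrt c) ^ 2 * D ^ 2 / ((ε * κ / 3) / 2) ^ 2) =
      15 * D + 432 * (K ^ 2 * c ^ 3 * D ^ 2) / (ε ^ 2 * κ ^ 2) := by
    rw [h5, mul_pow, mul_pow, mul_pow, Real.sq_sqrt hc0.le]
    field_simp
    ring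
  have hW0 : 0 ≤ 15 * D + 432 * (K ^ 2 * c ^ 3 * D ^ 2) / (ε ^ 2 * κ ^ 2) := by positivity
  have hcB : c * (K ^ 2 * c ^ 3 * D) ≤ ε ^ 2 * κ ^ 2 / 210000 := by
    calc c * (K ^ 2 * c ^ 3 * D) ≤ c * (ε ^ 3 * κ ^ 2 / (10000 * c ^ 2)) := mul_le_mul_of_nonneg_left hb hc0.le
      _ = ε ^ 3 * κ ^ 2 / (10000 * c) := by field_simp
      _ ≤ ε ^ 2 * κ ^ 2 / (10000 * c) := div_le_div_of_nonneg_right hε32 (by positivity)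
      _ ≤ ε ^ 2 * κ ^ 2 / 210000 := by
          apply div_le_div_of_nonneg_left hεκ.le (by norm_num)
          nlinarith
  have hB1 : K ^ 2 * c ^ 3 * D ≤ ε ^ 2 * κ ^ 2 / 210000 := by
    have : K ^ 2 * c ^ 3 * D ≤ c * (K ^ 2 * c ^ 3 * D) := by nlinarith
    exact this.trans hcB
  have hcB2 : c * (K ^ 2 * c ^ 3 * D) ^ 2 ≤ (ε ^ 2 * κ ^ 2 / 210000) * (ε ^ 2 * κ ^ 2 / 210000) := by
    calc c * (K ^ 2 * c ^ 3 * D) ^ 2 = (c * (K ^ 2 * c ^ 3 * D)) * (K ^ 2 * c ^ 3 * D) := by ring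
      _ ≤ (ε ^ 2 * κ ^ 2 / 210000) * (ε ^ 2 * κ ^ 2 / 210000) := mul_le_mul hcB hB1 hB0 (by positivity)
  have hU2sq : (c * (c * K / ((ε * κ / 3) / 2)) * Real.sqrt (15 * D + 432 * (K ^ 2 * c ^ 3 * D ^ 2) / (ε ^ 2 * κ ^ 2))) ^ 2 ≤
      (1 / 15) ^ 2 := by
    rw [mul_pow, Real.sq_sqrt hW0]
    have e1 : (c * (c * K / (ε * κ / 3 / 2))) ^ 2 * (15 * D + 432 * (K ^ 2 * c ^ 3 * D ^ 2) / (ε ^ 2 * κ ^ 2)) =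
        (540 * (c * (K ^ 2 * c ^ 3 * D)) * (ε ^ 2 * κ ^ 2) + 15552 * (c * (K ^ 2 * c ^ 3 * D) ^ 2)) / (ε ^ 4 * κ ^ 4) := by
      field_simp; ring
    rw [e1, div_le_iff₀ (by positivity)]
    have h1 : 540 * (c * (K ^ 2 * c ^ 3 * D)) * (ε ^ 2 * κ ^ 2) ≤ 540 * (ε ^ 2 * κ ^ 2 / 210000) * (ε ^ 2 * κ ^ 2) :=
      mul_le_mul_of_nonneg_right (mul_le_mul_of_nonneg_left hcB (by norm_num)) hεκ.le
    have h2 : 15552 * (c * (K ^ 2 * c ^ 3 * D) ^ 2) ≤ 15552 * ((ε ^ 2 * κ ^ 2 / 210000) * (ε ^ 2 * κ ^ 2 / 210000)) :=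
      mul_le_mul_of_nonneg_left hcB2 (by norm_num)
    have e2 : 540 * (ε ^ 2 * κ ^ 2 / 210000) * (ε ^ 2 * κ ^ 2) + 15552 * ((ε ^ 2 * κ ^ 2 / 210000) * (ε ^ 2 * κ ^ 2 / 210000)) ≤
        (1 / 15) ^ 2 * (ε ^ 4 * κ ^ 4) := by
      have h4 : 0 ≤ ε ^ 4 * κ ^ 4 := by positivity
      have e3 : 540 * (ε ^ 2 * κ ^ 2 / 210000) * (ε ^ 2 * κ ^ 2) + 15552 * ((ε ^ 2 * κ ^ 2 / 210000) * (ε ^ 2 * κ ^ 2 / 210000)) =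
          (540 / 210000 + 15552 / (210000 * 210000)) * (ε ^ 4 * κ ^ 4) := by ring
      rw [e3]
      exact mul_le_mul_of_nonneg_right (by norm_num) h4
    linarith
  have hU2 : c * (c * K / ((ε * κ / 3) / 2)) * Real.sqrt (15 * D + 432 * (K ^ 2 * c ^ 3 * D ^ 2) / (ε ^ 2 * κ ^ 2)) ≤ 1 / 15 :=
    (pow_le_pow_iff_left₀ (by positivity) (by norm_num) two_ne_zero).mp hU2sq
  rw [hWeq]
  linarith


/-- The POLYNOMIAL DEFICIT WINDOW implies both point hypotheses of the ε-form package: `F₀ ≤ t₀ := ρ²ε³κ²/(1032960·10⁴·L⁸(K+1)²c⁵)` ⇒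
`224L²√F₀ < ρ` and `D ≤ ε³κ²/(10⁴(K+1)²c⁵)`. [folklore] -/
theorem param_window {F ρ ε K c Lr : ℝ} (hρ : 0 < ρ) (hρ1 : ρ ≤ 1) (hε : 0 < ε) (hε1 : ε ≤ 1) (hK : 0 ≤ K) (hc : 21 ≤ c) (hL : 1 ≤ Lr)
    (ht : F ≤ ρ ^ 2 * ε ^ 3 * (ρ ^ 2 / (1032960 * Lr ^ 8)) ^ 2 / (1032960 * 10000 * Lr ^ 8 * (K + 1) ^ 2 * c ^ 5)) :
    224 * Lr ^ 2 * Real.sqrt F < ρ ∧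
      1032960 * Lr ^ 8 * F / ρ ^ 2 ≤ ε ^ 3 * (ρ ^ 2 / (1032960 * Lr ^ 8)) ^ 2 / (10000 * (K + 1) ^ 2 * c ^ 5) := by
  have hL0 : 0 < Lr := by linarith
  have hc1 : 1 ≤ c := by linarith
  constructor
  · -- F < ρ²/(224² L⁴)
    have hκ : ρ ^ 2 / (1032960 * Lr ^ 8) ≤ 1 := by
      rw [div_le_one (by positivity)]
      have h8 : (1 : ℝ) ≤ Lr ^ 8 := one_le_pow₀ hL
      nlinarith
    have hκ0 : 0 ≤ ρ ^ 2 / (1032960 * Lr ^ 8) := by positivity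
    have hden : 1032960 * 10000 * Lr ^ 8 ≤ 1032960 * 10000 * Lr ^ 8 * (K + 1) ^ 2 * c ^ 5 := by
      have h1 : (1 : ℝ) ≤ (K + 1) ^ 2 := by nlinarith
      have h2 : (1 : ℝ) ≤ c ^ 5 := one_le_pow₀ hc1
      have h0 : (0 : ℝ) ≤ 1032960 * 10000 * Lr ^ 8 := by positivity
      calc 1032960 * 10000 * Lr ^ 8 = 1032960 * 10000 * Lr ^ 8 * 1 * 1 := by ring
        _ ≤ 1032960 * 10000 * Lr ^ 8 * (K + 1) ^ 2 * c ^ 5 := by gcongr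
    have hnum : ρ ^ 2 * ε ^ 3 * (ρ ^ 2 / (1032960 * Lr ^ 8)) ^ 2 ≤ ρ ^ 2 := by
      have h1 : ε ^ 3 ≤ 1 := pow_le_one₀ hε.le hε1
      have h2 : (ρ ^ 2 / (1032960 * Lr ^ 8)) ^ 2 ≤ 1 := pow_le_one₀ hκ0 hκ
      calc ρ ^ 2 * ε ^ 3 * (ρ ^ 2 / (1032960 * Lr ^ 8)) ^ 2 ≤ ρ ^ 2 * 1 * 1 := by gcongr
        _ = ρ ^ 2 := by ring
    have hF1 : F ≤ ρ ^ 2 / (1032960 * 10000 * Lr ^ 8) := by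
      refine ht.trans ?_
      calc ρ ^ 2 * ε ^ 3 * (ρ ^ 2 / (1032960 * Lr ^ 8)) ^ 2 / (1032960 * 10000 * Lr ^ 8 * (K + 1) ^ 2 * c ^ 5)
          ≤ ρ ^ 2 / (1032960 * 10000 * Lr ^ 8 * (K + 1) ^ 2 * c ^ 5) := div_le_div_of_nonneg_right hnum (by positivity)
        _ ≤ ρ ^ 2 / (1032960 * 10000 * Lr ^ 8) := div_le_div_of_nonneg_left (by positivity) (by positivity) hden
    have hF2 : F < (ρ / (224 * Lr ^ 2)) ^ 2 := by
      refine lt_of_le_of_lt hF1 ?_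
      rw [div_pow, div_lt_div_iff₀ (by positivity) (by positivity)]
      have h4 : Lr ^ 8 = (Lr ^ 2) ^ 2 * Lr ^ 4 := by ring
      have hL4 : (1 : ℝ) ≤ Lr ^ 4 := one_le_pow₀ hL
      have hρ2 : 0 < ρ ^ 2 := by positivity
      nlinarith [mul_le_mul_of_nonneg_left hL4 (by positivity : (0 : ℝ) ≤ ρ ^ 2 * (224 * Lr ^ 2) ^ 2)]
    have hs : Real.sqrt F < ρ / (224 * Lr ^ 2) := by
      rw [Real.sqrt_lt' (by positivity)]
      exact hF2
    rw [lt_div_iff₀ (by positivity)] at hs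
    linarith
  · rw [div_le_iff₀ (by positivity)]
    calc 1032960 * Lr ^ 8 * F ≤ 1032960 * Lr ^ 8 * (ρ ^ 2 * ε ^ 3 * (ρ ^ 2 / (1032960 * Lr ^ 8)) ^ 2 /
          (1032960 * 10000 * Lr ^ 8 * (K + 1) ^ 2 * c ^ 5)) := mul_le_mul_of_nonneg_left ht (by positivity)
      _ = ε ^ 3 * (ρ ^ 2 / (1032960 * Lr ^ 8)) ^ 2 / (10000 * (K + 1) ^ 2 * c ^ 5) * ρ ^ 2 := by
          field_simp


/-! ## §2 The ε-form of the pointwise package -/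

variable {L : ℕ} [NeZero L]

open scoped Matrix.Norms.Frobenius

attribute [local instance 2000] Literature.MathematicalPhysics.QuantumFieldTheory.SUNBakryEmery.matTop

/-- `#ι = 18L⁴ + 3 ≥ 21`. [folklore] -/
theorem card_fixVar_mul_three_ge : (21 : ℝ) ≤ (Fintype.card (FixVar L × Fin 3) : ℝ) := by
  rw [card_fixVar_mul_three_real]
  have hL1 : (1 : ℝ) ≤ L := by exact_mod_cast NeZero.one_le
  nlinarith [one_le_pow₀ (n := 4) hL1]

/-- ★★★ **(E1), ε-form.**  At a slice-0 comb-gauged `ρ`-regular point with `224L²√F₀(P) < ρ` and the POLYNOMIAL deficit window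
`1032960L⁸F₀(P)/ρ² ≤ ε³κ²/(10⁴(K+1)²#ι⁵)` (`κ = ρ²/(1032960L⁸)`), with `λ⋆ = εκ/3`: `(1 − ε)·F₀(P) ≤ ½gᵀ(H + λ⋆1)⁻¹g`. [cite: Luscher1983, §2] -/
theorem fix_generic_drive_lower_eps [DecidableEq (FixVar L × Fin 3)] (P : ((Fin (2 * L - 1 + 1) → GaugeConfig 3 L SU2) × (Site 3 L → SU2))) (hP : ∀ e : Edge 3 L, treeEdge e = true → P.1 0 e = 1)
    {ρ : ℝ} (hρ : 0 < ρ)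
    (hfar : (∃ k : Fin 3, ρ ^ 2 ≤ 1 - (su2Quat (wrapReps (P.1 0) k)).re ^ 2) ∨ ρ ^ 2 ≤ 1 - (su2Quat (P.2 0)).re ^ 2)
    (hsmall : 224 * (L : ℝ) ^ 2 * Real.sqrt (ringDeficit L (fun _ => false) P) < ρ)
    {K ε : ℝ} (hK : 0 ≤ K) (hε : 0 < ε) (hε1 : ε ≤ 1)
    (hK3 : ∀ (Y₁ Y₂ Y₃ : ((Fin (2 * L - 1 + 1) × Edge 3 L) ⊕ Site 3 L) → Matrix (Fin 2) (Fin 2) ℂ) (b₁ b₂ b₃ : ℝ), 0 ≤ b₁ → 0 ≤ b₂ → 0 ≤ b₃ →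
      (∀ w, ‖Y₁ w‖ ≤ b₁) → (∀ w, ‖Y₂ w‖ ≤ b₂) → (∀ w, ‖Y₃ w‖ ≤ b₃) → ∀ Q : ((Fin (2 * L - 1 + 1) → GaugeConfig 3 L SU2) × (Site 3 L → SU2)),
      |frameD Y₁ (frameD Y₂ (frameD Y₃ (ringPoly L))) (ringCoord L Q)| ≤ K * b₁ * b₂ * b₃)
    (hD : 1032960 * (L : ℝ) ^ 8 * ringDeficit L (fun _ => false) P / ρ ^ 2 ≤
      ε ^ 3 * (ρ ^ 2 / (1032960 * (L : ℝ) ^ 8)) ^ 2 / (10000 * (K + 1) ^ 2 * (Fintype.card (FixVar L × Fin 3) : ℝ) ^ 5)) :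
    (1 - ε) * ringDeficit L (fun _ => false) P ≤
      (1 / 2) * (frameGrad (L := L) fixFrameStd (ringCoord L P) ⬝ᵥ
        ((frameHess (L := L) fixFrameStd (ringCoord L P) + (ε * (ρ ^ 2 / (1032960 * (L : ℝ) ^ 8)) / 3) •
            (1 : Matrix (FixVar L × Fin 3) (FixVar L × Fin 3) ℝ))⁻¹ *ᵥ
          frameGrad (L := L) fixFrameStd (ringCoord L P))) := by
  set κ := ρ ^ 2 / (1032960 * (L : ℝ) ^ 8) with hκ
  set c : ℝ := (Fintype.card (FixVar L × Fin 3) : ℝ) with hc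
  set D := 1032960 * (L : ℝ) ^ 8 * ringDeficit L (fun _ => false) P / ρ ^ 2 with hDdef
  have hL0 : (0 : ℝ) < L := by exact_mod_cast NeZero.pos L
  have hκ0 : 0 < κ := by rw [hκ]; positivity
  have hc21 : 21 ≤ c := card_fixVar_mul_three_ge
  have hF0 : 0 ≤ ringDeficit L (fun _ => false) P := ringDeficit_nonneg _ _
  have hD0 : 0 ≤ D := by rw [hDdef]; positivity
  have hsm2 : K * Real.sqrt (c * D) * c ≤ (ε * κ / 3) / 2 := param_smallness hε hε1 hK hκ0 hc21 hD0 hD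
  have hsm2' : K * Real.sqrt (Fintype.card (FixVar L × Fin 3) * (1032960 * (L : ℝ) ^ 8 * ringDeficit L (fun _ => false) P / ρ ^ 2)) *
      Fintype.card (FixVar L × Fin 3) ≤ (ε * κ / 3) / 2 := hsm2
  have key := fix_generic_drive_lower P hP hρ hfar hsmall hK (by positivity : 0 < ε * κ / 3) (by positivity : 0 < ε / 3)
    (by linarith : ε / 3 < 1) hK3 hsm2'
  have herr := param_drive_error hε hε1 hK hκ0 hc21 hD0 hD
  exact le_trans (mul_le_mul_of_nonneg_right herr hF0) key

/-- ★★★ **(E2), ε-form.**  Same point and window, `λ⋆ = εκ/3`, `B_i = ∂_{τ_i}H`: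
`½tr(A⁻¹H) − ½Σ_i(A⁻¹B_iA⁻¹g)_i ≤ ½(#ι − 4) + 1/8` (`= 9L⁴ − 3/8`). [cite: Luscher1983, §2] -/
theorem fix_generic_divergence_upper_eps [DecidableEq (FixVar L × Fin 3)] (P : ((Fin (2 * L - 1 + 1) → GaugeConfig 3 L SU2) × (Site 3 L → SU2))) (hP : ∀ e : Edge 3 L, treeEdge e = true → P.1 0 e = 1)
    {ρ : ℝ} (hρ : 0 < ρ)
    (hfar : (∃ k : Fin 3, ρ ^ 2 ≤ 1 - (su2Quat (wrapReps (P.1 0) k)).re ^ 2) ∨ ρ ^ 2 ≤ 1 - (su2Quat (P.2 0)).re ^ 2)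
    (hsmall : 224 * (L : ℝ) ^ 2 * Real.sqrt (ringDeficit L (fun _ => false) P) < ρ)
    {K ε : ℝ} (hK : 0 ≤ K) (hε : 0 < ε) (hε1 : ε ≤ 1)
    (hK3 : ∀ (Y₁ Y₂ Y₃ : ((Fin (2 * L - 1 + 1) × Edge 3 L) ⊕ Site 3 L) → Matrix (Fin 2) (Fin 2) ℂ) (b₁ b₂ b₃ : ℝ), 0 ≤ b₁ → 0 ≤ b₂ → 0 ≤ b₃ →
      (∀ w, ‖Y₁ w‖ ≤ b₁) → (∀ w, ‖Y₂ w‖ ≤ b₂) → (∀ w, ‖Y₃ w‖ ≤ b₃) → ∀ Q : ((Fin (2 * L - 1 + 1) → GaugeConfig 3 L SU2) × (Site 3 L → SU2)),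
      |frameD Y₁ (frameD Y₂ (frameD Y₃ (ringPoly L))) (ringCoord L Q)| ≤ K * b₁ * b₂ * b₃)
    (hD : 1032960 * (L : ℝ) ^ 8 * ringDeficit L (fun _ => false) P / ρ ^ 2 ≤
      ε ^ 3 * (ρ ^ 2 / (1032960 * (L : ℝ) ^ 8)) ^ 2 / (10000 * (K + 1) ^ 2 * (Fintype.card (FixVar L × Fin 3) : ℝ) ^ 5)) :
    (1 / 2) * Matrix.trace ((frameHess (L := L) fixFrameStd (ringCoord L P) + (ε * (ρ ^ 2 / (1032960 * (L : ℝ) ^ 8)) / 3) •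
            (1 : Matrix (FixVar L × Fin 3) (FixVar L × Fin 3) ℝ))⁻¹ * frameHess (L := L) fixFrameStd (ringCoord L P)) -
        (1 / 2) * ∑ i, ((frameHess (L := L) fixFrameStd (ringCoord L P) + (ε * (ρ ^ 2 / (1032960 * (L : ℝ) ^ 8)) / 3) •
            (1 : Matrix (FixVar L × Fin 3) (FixVar L × Fin 3) ℝ))⁻¹ *ᵥ
          ((fun j' k => frameD (fixFrameStd i) (fun M => frameHess (L := L) fixFrameStd M j' k) (ringCoord L P)) *ᵥ
            ((frameHess (L := L) fixFrameStd (ringCoord L P) + (ε * (ρ ^ 2 / (1032960 * (L : ℝ) ^ 8)) / 3) •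
                (1 : Matrix (FixVar L × Fin 3) (FixVar L × Fin 3) ℝ))⁻¹ *ᵥ
              frameGrad (L := L) fixFrameStd (ringCoord L P)))) i ≤
      (1 / 2) * ((Fintype.card (FixVar L × Fin 3) : ℝ) - 4) + 1 / 8 := by
  set κ := ρ ^ 2 / (1032960 * (L : ℝ) ^ 8) with hκ
  set c : ℝ := (Fintype.card (FixVar L × Fin 3) : ℝ) with hc
  set D := 1032960 * (L : ℝ) ^ 8 * ringDeficit L (fun _ => false) P / ρ ^ 2 with hDdef
  have hL0 : (0 : ℝ) < L := by exact_mod_cast NeZero.pos L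
  have hκ0 : 0 < κ := by rw [hκ]; positivity
  have hc21 : 21 ≤ c := card_fixVar_mul_three_ge
  have hF0 : 0 ≤ ringDeficit L (fun _ => false) P := ringDeficit_nonneg _ _
  have hD0 : 0 ≤ D := by rw [hDdef]; positivity
  have hsm2 : K * Real.sqrt (c * D) * c ≤ (ε * κ / 3) / 2 := param_smallness hε hε1 hK hκ0 hc21 hD0 hD
  have hsm2' : K * Real.sqrt (Fintype.card (FixVar L × Fin 3) * (1032960 * (L : ℝ) ^ 8 * ringDeficit L (fun _ => false) P / ρ ^ 2)) *
      Fintype.card (FixVar L × Fin 3) ≤ (ε * κ / 3) / 2 := hsm2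
  have key := fix_generic_divergence_upper P hP hρ hfar hsmall hK (by positivity : 0 < ε * κ / 3) hK3 hsm2'
  have herr := param_divergence_error hε hε1 hK hκ0 hc21 hD0 hD
  linarith

/-! ## §3 The window form: one deficit threshold `t₀`, polynomial in `L` -/

/-- ★★★ **(E1) under the deficit window.**  With `t₀ = ρ²ε³κ²/(1032960·10⁴·L⁸(K+1)²#ι⁵)` (`κ = ρ²/(1032960L⁸)`, `#ι = 18L⁴+3`): at every
slice-0 comb-gauged `ρ`-regular point with `F₀(P) ≤ t₀`, `(1 − ε)·F₀(P) ≤ ½gᵀ(H + (εκ/3)1)⁻¹g`. [cite: Luscher1983, §2] -/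
theorem fix_generic_drive_lower_window [DecidableEq (FixVar L × Fin 3)] (P : ((Fin (2 * L - 1 + 1) → GaugeConfig 3 L SU2) × (Site 3 L → SU2))) (hP : ∀ e : Edge 3 L, treeEdge e = true → P.1 0 e = 1)
    {ρ : ℝ} (hρ : 0 < ρ) (hρ1 : ρ ≤ 1)
    (hfar : (∃ k : Fin 3, ρ ^ 2 ≤ 1 - (su2Quat (wrapReps (P.1 0) k)).re ^ 2) ∨ ρ ^ 2 ≤ 1 - (su2Quat (P.2 0)).re ^ 2)
    {K ε : ℝ} (hK : 0 ≤ K) (hε : 0 < ε) (hε1 : ε ≤ 1)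
    (hK3 : ∀ (Y₁ Y₂ Y₃ : ((Fin (2 * L - 1 + 1) × Edge 3 L) ⊕ Site 3 L) → Matrix (Fin 2) (Fin 2) ℂ) (b₁ b₂ b₃ : ℝ), 0 ≤ b₁ → 0 ≤ b₂ → 0 ≤ b₃ →
      (∀ w, ‖Y₁ w‖ ≤ b₁) → (∀ w, ‖Y₂ w‖ ≤ b₂) → (∀ w, ‖Y₃ w‖ ≤ b₃) → ∀ Q : ((Fin (2 * L - 1 + 1) → GaugeConfig 3 L SU2) × (Site 3 L → SU2)),
      |frameD Y₁ (frameD Y₂ (frameD Y₃ (ringPoly L))) (ringCoord L Q)| ≤ K * b₁ * b₂ * b₃)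
    (ht : ringDeficit L (fun _ => false) P ≤ ρ ^ 2 * ε ^ 3 * (ρ ^ 2 / (1032960 * (L : ℝ) ^ 8)) ^ 2 /
      (1032960 * 10000 * (L : ℝ) ^ 8 * (K + 1) ^ 2 * (Fintype.card (FixVar L × Fin 3) : ℝ) ^ 5)) :
    (1 - ε) * ringDeficit L (fun _ => false) P ≤
      (1 / 2) * (frameGrad (L := L) fixFrameStd (ringCoord L P) ⬝ᵥ
        ((frameHess (L := L) fixFrameStd (ringCoord L P) + (ε * (ρ ^ 2 / (1032960 * (L : ℝ) ^ 8)) / 3) •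
            (1 : Matrix (FixVar L × Fin 3) (FixVar L × Fin 3) ℝ))⁻¹ *ᵥ
          frameGrad (L := L) fixFrameStd (ringCoord L P))) := by
  have hL1 : (1 : ℝ) ≤ L := by exact_mod_cast NeZero.one_le
  obtain ⟨hsmall, hD⟩ := param_window hρ hρ1 hε hε1 hK card_fixVar_mul_three_ge hL1 ht
  exact fix_generic_drive_lower_eps P hP hρ hfar hsmall hK hε hε1 hK3 hD

/-- ★★★ **(E2) under the deficit window.**  Same threshold `t₀`: `½tr(A⁻¹H) − ½Σ_i(A⁻¹B_iA⁻¹g)_i ≤ ½(#ι − 4) + 1/8` with `λ⋆ = εκ/3`.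
[cite: Luscher1983, §2] -/
theorem fix_generic_divergence_upper_window [DecidableEq (FixVar L × Fin 3)] (P : ((Fin (2 * L - 1 + 1) → GaugeConfig 3 L SU2) × (Site 3 L → SU2))) (hP : ∀ e : Edge 3 L, treeEdge e = true → P.1 0 e = 1)
    {ρ : ℝ} (hρ : 0 < ρ) (hρ1 : ρ ≤ 1)
    (hfar : (∃ k : Fin 3, ρ ^ 2 ≤ 1 - (su2Quat (wrapReps (P.1 0) k)).re ^ 2) ∨ ρ ^ 2 ≤ 1 - (su2Quat (P.2 0)).re ^ 2)
    {K ε : ℝ} (hK : 0 ≤ K) (hε : 0 < ε) (hε1 : ε ≤ 1)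
    (hK3 : ∀ (Y₁ Y₂ Y₃ : ((Fin (2 * L - 1 + 1) × Edge 3 L) ⊕ Site 3 L) → Matrix (Fin 2) (Fin 2) ℂ) (b₁ b₂ b₃ : ℝ), 0 ≤ b₁ → 0 ≤ b₂ → 0 ≤ b₃ →
      (∀ w, ‖Y₁ w‖ ≤ b₁) → (∀ w, ‖Y₂ w‖ ≤ b₂) → (∀ w, ‖Y₃ w‖ ≤ b₃) → ∀ Q : ((Fin (2 * L - 1 + 1) → GaugeConfig 3 L SU2) × (Site 3 L → SU2)),
      |frameD Y₁ (frameD Y₂ (frameD Y₃ (ringPoly L))) (ringCoord L Q)| ≤ K * b₁ * b₂ * b₃)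
    (ht : ringDeficit L (fun _ => false) P ≤ ρ ^ 2 * ε ^ 3 * (ρ ^ 2 / (1032960 * (L : ℝ) ^ 8)) ^ 2 /
      (1032960 * 10000 * (L : ℝ) ^ 8 * (K + 1) ^ 2 * (Fintype.card (FixVar L × Fin 3) : ℝ) ^ 5)) :
    (1 / 2) * Matrix.trace ((frameHess (L := L) fixFrameStd (ringCoord L P) + (ε * (ρ ^ 2 / (1032960 * (L : ℝ) ^ 8)) / 3) •
            (1 : Matrix (FixVar L × Fin 3) (FixVar L × Fin 3) ℝ))⁻¹ * frameHess (L := L) fixFrameStd (ringCoord L P)) -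
        (1 / 2) * ∑ i, ((frameHess (L := L) fixFrameStd (ringCoord L P) + (ε * (ρ ^ 2 / (1032960 * (L : ℝ) ^ 8)) / 3) •
            (1 : Matrix (FixVar L × Fin 3) (FixVar L × Fin 3) ℝ))⁻¹ *ᵥ
          ((fun j' k => frameD (fixFrameStd i) (fun M => frameHess (L := L) fixFrameStd M j' k) (ringCoord L P)) *ᵥ
            ((frameHess (L := L) fixFrameStd (ringCoord L P) + (ε * (ρ ^ 2 / (1032960 * (L : ℝ) ^ 8)) / 3) •
                (1 : Matrix (FixVar L × Fin 3) (FixVar L × Fin 3) ℝ))⁻¹ *ᵥ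
              frameGrad (L := L) fixFrameStd (ringCoord L P)))) i ≤
      (1 / 2) * ((Fintype.card (FixVar L × Fin 3) : ℝ) - 4) + 1 / 8 := by
  have hL1 : (1 : ℝ) ≤ L := by exact_mod_cast NeZero.one_le
  obtain ⟨hsmall, hD⟩ := param_window hρ hρ1 hε hε1 hK card_fixVar_mul_three_ge hL1 ht
  exact fix_generic_divergence_upper_eps P hP hρ hfar hsmall hK hε hε1 hK3 hD

end Summit.QuantumFields.YangMills.Theorems.VirialFluxGap.FrameHessian

end
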